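import Summits.Ventures.CertifiedArithmetic.Expansions.CompressTopStableTools
import Summits.Ventures.CertifiedArithmetic.Expansions.CompressValuationSteps

/-!
# The emitting step of COMPRESS: same roundoff or reflected roundoff (new work)

New work of the certified-arithmetic venture (ENGINES group: shared numerical engines serving
client cells; rigour lives in the verifiers; every published number belongs to a client cell's
ledger, not to the engines group), part of the series "COMPRESS twice keeps the top component"
(`Expansions/CompressTopStableTools.lean`).

THE SITUATION.  In the second (upward) traversal of Shewchuk's COMPRESS [Shewchuk1997, §2.7
Thm 23] the carry `Q` (a float, `|Q| ≤ ulp g`, the components emitted so far summing to `σ`,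
`|σ| < ulp Q`) meets the next component `g` (`|g| ≥ 2^(emin+p)`) and the FAST-TWO-SUM is inexact:
`Qn = fl(g + Q) ≠ g + Q`, roundoff `q = g + Q − Qn`.  WHICH float is `Qn`, and what is `q`?

THE THEOREM (`emit_dichotomy`, `p ≥ 2`, ANY round-to-nearest, assuming the SHARP STAIR under `g`
of `Expansions/CompressSharpStair.lean`: if `|g|` is a power of two and `Q + σ` points towards
zero then `|Q + σ| < ulp(g)/2`).  EITHER `Qn = g`, `q = Q` (the carry is emitted unchanged), OR,
for some `b` with `2^b ≤ |Q| < 2^(b+1)`: `Qn = g + sgn(Q)·2^(b+1)` is the float ADJACENT to `g`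
on the side of `Q` and `q = Q − sgn(Q)·2^(b+1)` is the REFLECTED carry — `q · Q < 0`,
`|q| + |Q| = 2^(b+1)` — and `Qn` absorbs every `x` on the side of `q` with `|x| < 2^b`.
(`2^(b+1) = ulp g`, except when `|g| = 2^(u+p−1)` and `Q` points towards zero: then the sharp
stair gives `|Q| < ulp(g)/2 = 2^(b+1)`.)  Tools: a number strictly between two ADJACENT floats
rounds to one of them (`fl_eq_or_eq_of_adjacent`, `fl_eq_of_adjacent_of_abs_lt`); no float lies
strictly between a float `a` and `a + sgn(a)·ulp a` (`no_float_between`).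

HONEST FRAMING: new work of this programme checked in Lean — elementary facts about rounding to
nearest around one step of a textbook procedure, not a published result and no open problem;
[Shewchuk1997, §2.7] and [BoldoEtAl2023, §2.1–2.2, Properties 2.7–2.9] supply the objects.
-/


namespace Summit.Ventures.CertifiedArithmetic.Expansions

open Literature.ComputerArithmetic.JeannerodRump2018
open Literature.ComputerArithmetic.BoldoJeannerodMelquiondMuller2023 hiding twoSum twoSum_fst
open Literature.ComputerArithmetic.JoldesMullerPopescu2017 (ulp_le_of_abs_lt_two_zpow)
open Literature.ComputerArithmetic.GraillatMuller2025 (ulp_two_zpow)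
open Literature.ComputerArithmetic.Shewchuk1997

variable {p : ℕ} {emin : ℤ} {fl : ℚ → ℚ}

/-! ### Rounding to nearest between two adjacent floats -/

/-- Powers of two at or above `2^emin` are floats (`p ≥ 1`). -/
private theorem zpow_isFloat (hp : 1 ≤ p) {k : ℤ} (hk : emin ≤ k) :
    IsFloat p emin ((2 : ℚ) ^ k) :=
  ⟨1, k, by rw [abs_one]; exact one_lt_pow₀ (by norm_num) (by omega), hk, by simp⟩

/-- `fl_eq_or_eq_of_adjacent` when `t` lies above `a` and below `a'`. -/
private theorem fl_eq_or_eq_of_adjacent_lt (hfl : IsRoundNearest p emin fl) {a a' t : ℚ}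
    (ha : IsFloat p emin a) (ha' : IsFloat p emin a')
    (hadj : ∀ f : ℚ, IsFloat p emin f → 0 ≤ (f - a) * (f - a'))
    (h1 : a < t) (h2 : t < a') : fl t = a ∨ fl t = a' := by
  obtain ⟨hF, hopt⟩ := hfl t
  have hpa := hopt a ha
  have hpa' := hopt a' ha'
  by_contra hne
  push Not at hne
  have hprod := hadj _ hF
  rcases lt_or_gt_of_ne hne.1 with hlo | hhi
  · rw [abs_of_pos (by linarith : 0 < t - fl t), abs_of_pos (by linarith : 0 < t - a)] at hpa
    linarith
  · have hge : a' ≤ fl t := by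
      by_contra hc
      rw [not_le] at hc
      linarith [mul_neg_of_pos_of_neg (sub_pos.mpr hhi) (sub_neg.mpr hc)]
    have hgt : a' < fl t := lt_of_le_of_ne hge (Ne.symm hne.2)
    rw [abs_of_neg (by linarith : t - fl t < 0), abs_of_neg (by linarith : t - a' < 0)] at hpa'
    linarith

/-- A number STRICTLY BETWEEN two floats `a`, `a'` with no float strictly between them rounds to
`a` or to `a'` under any round-to-nearest. [cite: BoldoEtAl2023, §2.2 Def. 2.3] -/
theorem fl_eq_or_eq_of_adjacent (hfl : IsRoundNearest p emin fl) {a a' t : ℚ}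
    (ha : IsFloat p emin a) (ha' : IsFloat p emin a')
    (hadj : ∀ f : ℚ, IsFloat p emin f → 0 ≤ (f - a) * (f - a'))
    (ht : (t - a) * (t - a') < 0) : fl t = a ∨ fl t = a' := by
  rcases mul_neg_iff.mp ht with ⟨h1, h2⟩ | ⟨h1, h2⟩
  · exact fl_eq_or_eq_of_adjacent_lt hfl ha ha' hadj (by linarith) (by linarith)
  · exact (fl_eq_or_eq_of_adjacent_lt hfl ha' ha (fun f hf => by rw [mul_comm]; exact hadj f hf)
      (by linarith) (by linarith)).symm

/-- … and to `a` if it is strictly nearer to `a`. [cite: BoldoEtAl2023, §2.2 Def. 2.3] -/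
theorem fl_eq_of_adjacent_of_abs_lt (hfl : IsRoundNearest p emin fl) {a a' t : ℚ}
    (ha : IsFloat p emin a) (ha' : IsFloat p emin a')
    (hadj : ∀ f : ℚ, IsFloat p emin f → 0 ≤ (f - a) * (f - a'))
    (ht : (t - a) * (t - a') < 0) (hnear : |t - a| < |t - a'|) : fl t = a := by
  rcases fl_eq_or_eq_of_adjacent hfl ha ha' hadj ht with h | h
  · exact h
  · have := (hfl t).2 a ha
    rw [h] at this
    linarith

/-- NO FLOAT STRICTLY BETWEEN a nonzero float `a` and the number `b` one `ulp a` beyond it (same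
sign, `|b| = |a| + ulp a`). [cite: BoldoEtAl2023, §2.1 Def. 2.4] -/
theorem no_float_between {a b : ℚ} (ha : IsFloat p emin a) (hab : 0 < a * b)
    (hb : |b| = |a| + ulp p emin a) : ∀ f : ℚ, IsFloat p emin f → 0 ≤ (f - a) * (f - b) := by
  intro f hf
  by_contra hneg
  rw [not_le] at hneg
  have hupos := ulp_pos (p := p) (emin := emin) a
  have ha0 : a ≠ 0 := by rintro rfl; simp at hab
  rcases lt_or_gt_of_ne ha0 with ha0 | ha0
  · have hb0 : b < 0 := by
      by_contra h; rw [not_lt] at h; nlinarith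
    rw [abs_of_neg ha0, abs_of_neg hb0] at hb
    rcases mul_neg_iff.mp hneg with ⟨h1, h2⟩ | ⟨h1, h2⟩
    · linarith
    · have hfa : |a| < |f| := by
        rw [abs_of_neg ha0, abs_of_neg (by linarith : f < 0)]; linarith
      have := abs_add_ulp_le_abs hf ha hfa
      rw [abs_of_neg ha0, abs_of_neg (by linarith : f < 0)] at this
      linarith
  · have hb0 : 0 < b := by
      by_contra h; rw [not_lt] at h; nlinarith
    rw [abs_of_pos ha0, abs_of_pos hb0] at hb
    rcases mul_neg_iff.mp hneg with ⟨h1, h2⟩ | ⟨h1, h2⟩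
    · have hfa : |a| < |f| := by
        rw [abs_of_pos ha0, abs_of_pos (by linarith : 0 < f)]; linarith
      have := abs_add_ulp_le_abs hf ha hfa
      rw [abs_of_pos ha0, abs_of_pos (by linarith : 0 < f)] at this
      linarith
    · linarith

/-! ### The emitting step -/

/-- THE REFLECTED CASE, from adjacency: if `fl(g + Q)` is a float `g'` at distance `2^(b+1)` from
`g` on the side of `Q`, with no float strictly between `g` and `g'`, and `|Q| < 2^(b+1)`, then
`2^b ≤ |Q|`, the roundoff `q = g + Q − g'` points against `Q` with `|q| + |Q| = 2^(b+1)`, and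
everything on the side of `q` shorter than `2^b` is absorbed by `g'`.
[cite: BoldoEtAl2023, §2.2 (round-to-nearest)] -/
theorem emit_reflected (hfl : IsRoundNearest p emin fl) {g g' Q : ℚ} {b : ℤ}
    (hg : IsFloat p emin g) (hg' : IsFloat p emin g')
    (hadj : ∀ f : ℚ, IsFloat p emin f → 0 ≤ (f - g') * (f - g))
    (hD : |g' - g| = (2 : ℚ) ^ (b + 1)) (hQD : 0 < Q * (g' - g)) (hQlt : |Q| < (2 : ℚ) ^ (b + 1))
    (hQn : fl (g + Q) = g') :
    (2 : ℚ) ^ b ≤ |Q| ∧ |Q| < (2 : ℚ) ^ (b + 1) ∧ (g + Q - fl (g + Q)) * Q < 0 ∧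
      |g + Q - fl (g + Q)| + |Q| = (2 : ℚ) ^ (b + 1) ∧
      ∀ x : ℚ, 0 < x * (g + Q - fl (g + Q)) → |x| < (2 : ℚ) ^ b →
        fl (fl (g + Q) + x) = fl (g + Q) := by
  have hnear : |g + Q - g'| ≤ |Q| := by
    have := (hfl (g + Q)).2 g hg
    rwa [hQn, show g + Q - g = Q by ring] at this
  have hb2 : (2 : ℚ) ^ (b + 1) = 2 * 2 ^ b := by rw [zpow_add_one₀ (by norm_num)]; ring
  rw [hQn, show g + Q - g' = Q - (g' - g) by ring]
  rw [show g + Q - g' = Q - (g' - g) by ring] at hnear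
  have hgap : |g - g'| = (2 : ℚ) ^ (b + 1) := by rw [abs_sub_comm]; exact hD
  rcases mul_pos_iff.mp hQD with ⟨hQ0, hD0⟩ | ⟨hQ0, hD0⟩
  · rw [abs_of_pos hD0] at hD
    rw [abs_of_pos hQ0] at hQlt hnear ⊢
    have hqneg : Q - (g' - g) < 0 := by linarith
    rw [abs_of_neg hqneg] at hnear ⊢
    refine ⟨by linarith, hQlt, mul_neg_of_neg_of_pos hqneg hQ0, by linarith, ?_⟩
    intro x hx hxb
    have hx0 : x < 0 := by
      by_contra h; rw [not_lt] at h; nlinarith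
    exact fl_add_eq_self_of_gap hfl hg' hadj (mul_pos_of_neg_of_neg hx0 (by linarith))
      (by rw [hgap, hb2, abs_of_neg hx0]; rw [abs_of_neg hx0] at hxb; linarith)
  · rw [abs_of_neg hD0] at hD
    rw [abs_of_neg hQ0] at hQlt hnear ⊢
    have hqpos : 0 < Q - (g' - g) := by linarith
    rw [abs_of_pos hqpos] at hnear ⊢
    refine ⟨by linarith, hQlt, mul_neg_of_pos_of_neg hqpos hQ0, by linarith, ?_⟩
    intro x hx hxb
    have hx0 : 0 < x := by
      by_contra h; rw [not_lt] at h; nlinarith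
    exact fl_add_eq_self_of_gap hfl hg' hadj (mul_pos hx0 (by linarith))
      (by rw [hgap, hb2, abs_of_pos hx0]; rw [abs_of_pos hx0] at hxb; linarith)

/-- The dichotomy for `g > 0` (the general case follows by mirroring). -/
private theorem emit_dichotomy_pos (hp : 2 ≤ p) (hfl : IsRoundNearest p emin fl) {g Q σ : ℚ}
    (hg : IsFloat p emin g) (hgpos : 0 < g) (hgbig : (2 : ℚ) ^ (emin + p) ≤ |g|)
    (hQ : IsFloat p emin Q) (hQg : |Q| ≤ ulp p emin g) (hσ : |σ| < ulp p emin Q)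
    (hsharp : (∃ j : ℤ, emin + p ≤ j ∧ |g| = 2 ^ j) → g * (Q + σ) < 0 →
      |Q + σ| < ulp p emin g / 2)
    (hne : fl (g + Q) ≠ g + Q) :
    g + Q - fl (g + Q) = Q ∨
    ∃ b : ℤ, (2 : ℚ) ^ b ≤ |Q| ∧ |Q| < (2 : ℚ) ^ (b + 1) ∧ (g + Q - fl (g + Q)) * Q < 0 ∧
      |g + Q - fl (g + Q)| + |Q| = (2 : ℚ) ^ (b + 1) ∧
      ∀ x : ℚ, 0 < x * (g + Q - fl (g + Q)) → |x| < (2 : ℚ) ^ b →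
        fl (fl (g + Q) + x) = fl (g + Q) := by
  have hp1 : 1 ≤ p := le_trans (by norm_num) hp
  have h2 : (2 : ℚ) ≠ 0 := by norm_num
  have hnf : ¬ IsFloat p emin (g + Q) := fun hf => hne (fl_eq_self hfl hf)
  have hQ0 : Q ≠ 0 := by rintro rfl; exact hnf (by rw [add_zero]; exact hg)
  obtain ⟨u, hu, hU⟩ := exists_ulp_eq_two_zpow (p := p) (emin := emin) g
  have hUpos : (0 : ℚ) < (2 : ℚ) ^ u := zpow_pos (by norm_num) _
  have hga : |g| = g := abs_of_pos hgpos; rw [hga] at hgbig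
  have hg_lt : g < (2 : ℚ) ^ (u + p) := by
    have h := abs_lt_two_pow_mul_ulp (p := p) (emin := emin) g
    rw [hU, hga] at h
    calc g < 2 ^ p * (2 : ℚ) ^ u := h
      _ = (2 : ℚ) ^ (u + p) := by rw [← zpow_natCast, ← zpow_add₀ h2, add_comm]
  have hu1 : emin + 1 ≤ u := by
    by_contra h; rw [show u = emin by omega] at hg_lt; linarith
  have hmg : OnGrid u g := onGrid_of_two_zpow_le_ulp hg (by rw [hU])
  have hglow : (2 : ℚ) ^ (u + p - 1) ≤ g := by
    have := two_zpow_le_abs_of_ulp_eq hU (by omega); rwa [hga] at this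
  -- `|Q| < ulp g` strictly: equality would put `g + Q` on the grid of `ulp g` in range
  have hQlt : |Q| < (2 : ℚ) ^ u := by
    rw [hU] at hQg
    rcases hQg.lt_or_eq with h | h; · exact h
    · exfalso
      have hmQ : OnGrid u Q := by
        rcases (abs_eq hUpos.le).mp h with h' | h'
        · rw [h']; exact OnGrid.two_zpow le_rfl
        · rw [h']; exact (OnGrid.two_zpow le_rfl).neg
      have hge : (2 : ℚ) ^ (u + p) ≤ |g + Q| :=
        two_zpow_le_abs_of_onGrid_of_not_isFloat hu (hmg.add hmQ) hnf
      have hgle : g ≤ (2 : ℚ) ^ (u + p) - (2 : ℚ) ^ u := by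
        have := abs_le_sub_of_abs_lt_two_zpow hp1 hg (show |g| < (2 : ℚ) ^ (u + p) by
          rwa [hga])
        rwa [hga, show u + (p : ℤ) - p = u by ring] at this
      have heq : |g + Q| = (2 : ℚ) ^ (u + p) :=
        le_antisymm (by linarith [abs_add_le g Q]) hge
      apply hnf
      rcases (abs_eq (zpow_pos (by norm_num : (0 : ℚ) < 2) _).le).mp heq with h' | h'
      · rw [h']; exact zpow_isFloat hp1 (by omega)
      · rw [h']; exact (zpow_isFloat hp1 (by omega)).neg
  have hfin : ∀ (g' : ℚ) (b : ℤ), IsFloat p emin g' →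
      (∀ f : ℚ, IsFloat p emin f → 0 ≤ (f - g') * (f - g)) →
      |g' - g| = (2 : ℚ) ^ (b + 1) → 0 < Q * (g' - g) → |Q| < (2 : ℚ) ^ (b + 1) →
      (g + Q - g') * (g + Q - g) < 0 →
      g + Q - fl (g + Q) = Q ∨
      ∃ b : ℤ, (2 : ℚ) ^ b ≤ |Q| ∧ |Q| < (2 : ℚ) ^ (b + 1) ∧ (g + Q - fl (g + Q)) * Q < 0 ∧
        |g + Q - fl (g + Q)| + |Q| = (2 : ℚ) ^ (b + 1) ∧
        ∀ x : ℚ, 0 < x * (g + Q - fl (g + Q)) → |x| < (2 : ℚ) ^ b →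
          fl (fl (g + Q) + x) = fl (g + Q) := by
    intro g' b hg'F hadj hD hQD hQb hbetween
    rcases fl_eq_or_eq_of_adjacent hfl hg'F hg hadj hbetween with h | h
    · exact Or.inr ⟨b, emit_reflected hfl hg hg'F hadj hD hQD hQb h⟩
    · exact Or.inl (by rw [h]; ring)
  rcases lt_or_gt_of_ne hQ0 with hQneg | hQpos
  · -- `Q` points towards zero
    have hQa : |Q| = -Q := abs_of_neg hQneg
    rcases hglow.lt_or_eq with hgt | hgeq
    · -- (a) `g > 2^(u+p-1)`: then `g ≥ 2^(u+p-1) + 2^u` and `g - 2^u` keeps the binade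
      have hge : (2 : ℚ) ^ (u + p - 1) + (2 : ℚ) ^ u ≤ g :=
        (OnGrid.two_zpow (by omega : u ≤ u + p - 1)).add_two_zpow_le hmg hgt
      have hg'F : IsFloat p emin (g - (2 : ℚ) ^ u) := (isFloat_add_ulp_signed hp1 hg hU hu).2
      have hg'pos : 0 < g - (2 : ℚ) ^ u := by
        linarith [zpow_pos (by norm_num : (0 : ℚ) < 2) (u + p - 1)]
      have hulp' : ulp p emin (g - (2 : ℚ) ^ u) = (2 : ℚ) ^ u := by
        apply le_antisymm
        · have := ulp_mono (p := p) (emin := emin)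
            (show |g - (2 : ℚ) ^ u| ≤ |g| by rw [abs_of_pos hg'pos, hga]; linarith)
          rwa [hU] at this
        · have := ulp_mono (p := p) (emin := emin)
            (show |(2 : ℚ) ^ (u + p - 1)| ≤ |g - (2 : ℚ) ^ u| by
              rw [abs_of_pos (zpow_pos (by norm_num) _), abs_of_pos hg'pos]; linarith)
          rwa [ulp_two_zpow (by omega : emin ≤ (u + p - 1) - p + 1),
            show u + (p : ℤ) - 1 - p + 1 = u by ring] at this
      have hadj := no_float_between hg'F (mul_pos hg'pos hgpos)
        (by rw [hga, abs_of_pos hg'pos, hulp']; ring)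
      have e : u - 1 + 1 = u := by ring
      refine hfin _ (u - 1) hg'F hadj (by rw [e, show g - (2 : ℚ) ^ u - g = -(2 : ℚ) ^ u by ring,
        abs_neg, abs_of_pos hUpos]) ?_ (by rw [e]; exact hQlt) ?_
      · rw [show g - (2 : ℚ) ^ u - g = -(2 : ℚ) ^ u by ring]; nlinarith
      · rw [show g + Q - (g - (2 : ℚ) ^ u) = Q + (2 : ℚ) ^ u by ring, show g + Q - g = Q by ring]
        rw [hQa] at hQlt
        exact mul_neg_of_pos_of_neg (by linarith) hQneg
    · -- (b) `g = 2^(u+p-1)` is a power of two: the SHARP STAIR keeps `Q` within `ulp(g)/2`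
      have hh : (0 : ℚ) < (2 : ℚ) ^ (u - 1) := zpow_pos (by norm_num) _
      have e2 : (2 : ℚ) ^ u = 2 * (2 : ℚ) ^ (u - 1) := by
        rw [show u = u - 1 + 1 by ring, zpow_add_one₀ h2]; ring_nf
      have hg'F : IsFloat p emin (g - (2 : ℚ) ^ (u - 1)) := by
        refine ⟨2 ^ p - 1, u - 1, ?_, by omega, ?_⟩
        · have h1 : (1 : ℤ) ≤ 2 ^ p := one_le_pow₀ (by norm_num)
          rw [abs_of_nonneg (by omega)]; omega
        · rw [← hgeq, show u + (p : ℤ) - 1 = (u - 1) + p by ring, zpow_add₀ h2, zpow_natCast]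
          push_cast; ring
      have hg'pos : 0 < g - (2 : ℚ) ^ (u - 1) := by
        rw [← hgeq]
        have : (2 : ℚ) ^ (u - 1) < (2 : ℚ) ^ (u + p - 1) :=
          zpow_lt_zpow_right₀ (by norm_num) (by omega)
        linarith
      have hulp' : ulp p emin (g - (2 : ℚ) ^ (u - 1)) = (2 : ℚ) ^ (u - 1) := by
        apply le_antisymm
        · have := ulp_le_of_abs_lt_two_zpow (p := p) (emin := emin)
            (show |g - (2 : ℚ) ^ (u - 1)| < (2 : ℚ) ^ (u + p - 1) by
              rw [abs_of_pos hg'pos]; linarith) (by omega : emin ≤ u + p - 1 - p)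
          rwa [show u + (p : ℤ) - 1 - p = u - 1 by ring] at this
        · have hlow : (2 : ℚ) ^ (u + p - 2) ≤ g - (2 : ℚ) ^ (u - 1) := by
            have e3 : (2 : ℚ) ^ (u + p - 1) = 2 * (2 : ℚ) ^ (u + p - 2) := by
              rw [show u + (p : ℤ) - 1 = (u + p - 2) + 1 by ring, zpow_add_one₀ h2]; ring
            have : (2 : ℚ) ^ (u - 1) ≤ (2 : ℚ) ^ (u + p - 2) :=
              zpow_le_zpow_right₀ (by norm_num) (by omega)
            linarith
          have := ulp_mono (p := p) (emin := emin)
            (show |(2 : ℚ) ^ (u + p - 2)| ≤ |g - (2 : ℚ) ^ (u - 1)| by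
              rw [abs_of_pos (zpow_pos (by norm_num) _), abs_of_pos hg'pos]; exact hlow)
          rwa [ulp_two_zpow (by omega : emin ≤ (u + p - 2) - p + 1),
            show u + (p : ℤ) - 2 - p + 1 = u - 1 by ring] at this
      -- the sharp stair: `|Q + σ| < 2^(u-1)`, hence `|Q| ≤ 2^(u-1)` on the grid of `ulp Q` …
      have hsgn : g * (Q + σ) < 0 := by
        have : |σ| < -Q := by
          rw [← hQa]; exact hσ.trans_le (ulp_le_abs_of_isFloat hQ hQ0)
        exact mul_neg_of_pos_of_neg hgpos (by linarith [le_abs_self σ])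
      have hstair : |Q + σ| < (2 : ℚ) ^ (u - 1) := by
        have := hsharp ⟨u + p - 1, by omega, by rw [hga, hgeq]⟩ hsgn
        rw [hU, e2] at this
        linarith
      obtain ⟨k, hk, hK⟩ := exists_ulp_eq_two_zpow (p := p) (emin := emin) Q
      have hkQ : OnGrid k Q := by
        obtain ⟨K, hK'⟩ := exists_eq_int_mul_ulp_of_isFloat (p := p) (emin := emin) hQ
        exact ⟨K, by rw [← hK]; exact hK'⟩
      have hulpQ : ulp p emin Q ≤ (2 : ℚ) ^ (u - 1) := by
        rcases le_or_gt emin (u - p) with h | h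
        · exact (ulp_le_of_abs_lt_two_zpow hQlt h).trans
            (zpow_le_zpow_right₀ (by norm_num) (by omega))
        · have hQsmall : |Q| < (2 : ℚ) ^ (emin + p - 1) :=
            hQlt.trans_le (zpow_le_zpow_right₀ (by norm_num) (by omega))
          rw [ulp_eq_of_abs_lt hQsmall]
          exact zpow_le_zpow_right₀ (by norm_num) (by omega)
      have hkm : k ≤ u - 1 :=
        (zpow_le_zpow_iff_right₀ (by norm_num : (1 : ℚ) < 2)).mp (by rw [← hK]; exact hulpQ)
      have hQle : |Q| ≤ (2 : ℚ) ^ (u - 1) :=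
        abs_le_two_zpow_of_onGrid hkm hkQ (by rw [← hK]; exact hσ) hstair
      -- … and `< 2^(u-1)`: equality would make `g + Q = g - 2^(u-1)` a float
      have hQlt' : |Q| < (2 : ℚ) ^ (u - 1) := by
        rcases hQle.lt_or_eq with h | h; · exact h
        · exfalso; apply hnf; rw [hQa] at h
          rw [show g + Q = g - (2 : ℚ) ^ (u - 1) by linarith]; exact hg'F
      have hadj := no_float_between hg'F (mul_pos hg'pos hgpos)
        (by rw [hga, abs_of_pos hg'pos, hulp']; ring)
      have e : u - 2 + 1 = u - 1 := by ring
      refine hfin _ (u - 2) hg'F hadj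
        (by rw [e, show g - (2 : ℚ) ^ (u - 1) - g = -(2 : ℚ) ^ (u - 1) by ring, abs_neg,
          abs_of_pos hh]) ?_ (by rw [e]; exact hQlt') ?_
      · rw [show g - (2 : ℚ) ^ (u - 1) - g = -(2 : ℚ) ^ (u - 1) by ring]; nlinarith
      · rw [show g + Q - (g - (2 : ℚ) ^ (u - 1)) = Q + (2 : ℚ) ^ (u - 1) by ring,
          show g + Q - g = Q by ring]
        rw [hQa] at hQlt'
        exact mul_neg_of_pos_of_neg (by linarith) hQneg
  · -- `Q` points away from zero: `g + ulp g` is the adjacent float on that side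
    have hQa : |Q| = Q := abs_of_pos hQpos
    have hg'F : IsFloat p emin (g + (2 : ℚ) ^ u) := (isFloat_add_ulp_signed hp1 hg hU hu).1
    have hadj : ∀ f : ℚ, IsFloat p emin f → 0 ≤ (f - (g + (2 : ℚ) ^ u)) * (f - g) := by
      intro f hf
      rw [mul_comm]
      exact no_float_between hg (mul_pos hgpos (by linarith))
        (by rw [hga, abs_of_pos (by linarith : 0 < g + (2 : ℚ) ^ u), hU]) f hf
    have e : u - 1 + 1 = u := by ring
    refine hfin _ (u - 1) hg'F hadj
      (by rw [e, show g + (2 : ℚ) ^ u - g = (2 : ℚ) ^ u by ring, abs_of_pos hUpos])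
      (by rw [show g + (2 : ℚ) ^ u - g = (2 : ℚ) ^ u by ring]; exact mul_pos hQpos hUpos)
      (by rw [e]; exact hQlt) ?_
    rw [show g + Q - (g + (2 : ℚ) ^ u) = Q - (2 : ℚ) ^ u by ring, show g + Q - g = Q by ring]
    rw [hQa] at hQlt
    exact mul_neg_of_neg_of_pos (by linarith) hQpos

/-- **THE EMIT DICHOTOMY** (`p ≥ 2`, ANY round-to-nearest).  Second traversal of COMPRESS, carry
`Q` (a float, `|Q| ≤ ulp g`, emitted components summing to `σ` with `|σ| < ulp Q`), next
component `g` (`|g| ≥ 2^(emin+p)`) obeying the SHARP STAIR, inexact step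
`Qn = fl(g + Q) ≠ g + Q`, roundoff `q = g + Q − Qn`.  Then EITHER `q = Q` (and `Qn = g`), OR
for some `b` with `2^b ≤ |Q| < 2^(b+1)`: `q · Q < 0`, `|q| + |Q| = 2^(b+1)`
(`q = Q − sgn(Q)·2^(b+1)`, `Qn = g + sgn(Q)·2^(b+1)`), and `Qn` absorbs every `x` on the side of
`q` with `|x| < 2^b` (`g` is the float adjacent to `Qn` on that side, at distance `2^(b+1)`).
[cite: Shewchuk1997, §2.7 Thm 23 p. 333 (Lines 11–12)] [cite: BoldoEtAl2023, §2.2, §2.6] -/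
theorem emit_dichotomy (hp : 2 ≤ p) (hfl : IsRoundNearest p emin fl) {g Q σ : ℚ}
    (hg : IsFloat p emin g) (hgbig : (2 : ℚ) ^ (emin + p) ≤ |g|)
    (hQ : IsFloat p emin Q) (hQg : |Q| ≤ ulp p emin g) (hσ : |σ| < ulp p emin Q)
    (hsharp : (∃ j : ℤ, emin + p ≤ j ∧ |g| = 2 ^ j) → g * (Q + σ) < 0 →
      |Q + σ| < ulp p emin g / 2)
    (hne : fl (g + Q) ≠ g + Q) :
    g + Q - fl (g + Q) = Q ∨
    ∃ b : ℤ, (2 : ℚ) ^ b ≤ |Q| ∧ |Q| < (2 : ℚ) ^ (b + 1) ∧ (g + Q - fl (g + Q)) * Q < 0 ∧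
      |g + Q - fl (g + Q)| + |Q| = (2 : ℚ) ^ (b + 1) ∧
      ∀ x : ℚ, 0 < x * (g + Q - fl (g + Q)) → |x| < (2 : ℚ) ^ b →
        fl (fl (g + Q) + x) = fl (g + Q) := by
  have hg0 : g ≠ 0 := by
    intro h; rw [h, abs_zero] at hgbig; linarith [zpow_pos (by norm_num : (0 : ℚ) < 2) (emin + p)]
  rcases lt_or_gt_of_ne hg0 with hgneg | hgpos
  · -- mirror image: apply the positive case to `-g, -Q, -σ` and the rounding `t ↦ -fl (-t)`
    have h := emit_dichotomy_pos hp hfl.neg (g := -g) (Q := -Q) (σ := -σ) hg.neg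
      (neg_pos.mpr hgneg) (by rwa [abs_neg]) hQ.neg (by rwa [abs_neg, ulp_neg])
      (by rwa [abs_neg, ulp_neg]) ?_ ?_
    · rw [show -(-g + -Q) = g + Q by ring] at h
      have hq : -g + -Q - -fl (g + Q) = -(g + Q - fl (g + Q)) := by ring
      rw [hq, abs_neg, abs_neg] at h
      rcases h with h | ⟨b, h1, h2, h3, h4, h5⟩
      · exact Or.inl (by linarith)
      · refine Or.inr ⟨b, h1, h2, by linarith, h4, fun x hx hxb => ?_⟩
        have := h5 (-x) (by linarith) (by rwa [abs_neg])
        rw [show -(-fl (g + Q) + -x) = fl (g + Q) + x by ring] at this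
        linarith
    · intro hj hs
      rw [abs_neg] at hj; rw [ulp_neg, show -Q + -σ = -(Q + σ) by ring, abs_neg]
      exact hsharp hj (by linarith)
    · intro h; apply hne; rw [show -(-g + -Q) = g + Q by ring] at h; linarith
  · exact emit_dichotomy_pos hp hfl hg hgpos hgbig hQ hQg hσ hsharp hne

end Summit.Ventures.CertifiedArithmetic.Expansions
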